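import Summits.NavierStokesRegularity.NavierStokesRegularity.Theses.AxisTwistDoor
import Summits.NavierStokesRegularity.NavierStokesRegularity.Theorems.RellichScarSimilarityCovarianceScaling
import Literature.Analysis.FluidPDE.KNSSTypeIRateMildProofs
import Literature.Analysis.FluidPDE.LeraySelfSimilarCalculus
import Literature.Analysis.FluidPDE.FlatSwirlGauge

/-!
# AxisTwistDoor — support `ScalingToUnit` (item stmt-NavierStokesRegularity-26992): PARABOLIC SCALING TO THE UNIT CYLINDER

`ScalingToUnit : AveragedConeLiouville → (localised averaged cone on {−δ² < s < 0, r < δ, |z| < δ} ⇒ not backward-singular)`: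
apply `AveragedConeLiouville` to the rescaled profile `w = nsRescale δ v`, `w(s,y) = δ v(δ²s, δy)`.  Every hypothesis of the
class is scaling-covariant by a NAMED tree lemma — `HasTypeITimeDecay.nsRescale`, the continuity of `uncurry w`
(`continuousOn_uncurry_nsRescale_slab`), the Oseen-mild identity (`heatExtension_smul_stPull`, `oseenDuhamel_smul_stPull` via
`nsRescale_eq_smul_stPull`), `divergence_smul_comp_smul`, `isSuitableWeakSolutionOn_nsRescale`,
`hasWeakSpatialGradientOn_nsRescale`, `typeIBound_nsRescale`; the sign by `curl_smul_comp_smul`; the LOCAL cone of `v` becomes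
the UNIT-cylinder cone of `w` with `K` unchanged and `M ↦ Mδ²` (the circle point `(r cos θ, r sin θ, z)` scales to
`(δr cos θ, δr sin θ, δz)`, no change of variable in `θ`); finally `isBackwardSingularPoint_nsRescale` transports the
singularity of the origin.  Routine plumbing (critic-of-record P2/P4).  NS regularity is NOT proved here; the crux
`AveragedConeLiouville` stays OPEN.
-/

noncomputable section

set_option linter.dupNamespace false

namespace Summit.NavierStokesRegularity.NavierStokesRegularity.Theorems.AxisTwistDoorScalingToUnit

open MeasureTheory Set Function Filter Topology Metric
open scoped RealInnerProductSpace
open Literature.Analysis Literature.Analysis.FluidPDE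
open Summit.NavierStokesRegularity.NavierStokesRegularity.Theorems.RellichScarSimilarityCovariance

/-! ## §1 Small covariance lemmas -/

/-- continuity of `uncurry (nsRescale c V)` on the lower slab. -/
theorem continuousOn_uncurry_nsRescale_slab {V : ℝ → (EuclideanSpace ℝ (Fin 3)) → (EuclideanSpace ℝ (Fin 3))}
    (hV : ContinuousOn (uncurry V) (Iio (0 : ℝ) ×ˢ (univ : Set (EuclideanSpace ℝ (Fin 3))))) {c : ℝ} (hc : 0 < c) :
    ContinuousOn (uncurry (nsRescale c V)) (Iio (0 : ℝ) ×ˢ (univ : Set (EuclideanSpace ℝ (Fin 3)))) := by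
  have hΦ : Continuous fun z : ℝ × (EuclideanSpace ℝ (Fin 3)) => ((c ^ 2 * z.1, c • z.2) : ℝ × (EuclideanSpace ℝ (Fin 3))) := by fun_prop
  have hmaps : MapsTo (fun z : ℝ × (EuclideanSpace ℝ (Fin 3)) => ((c ^ 2 * z.1, c • z.2) : ℝ × (EuclideanSpace ℝ (Fin 3))))
      (Iio (0 : ℝ) ×ˢ (univ : Set (EuclideanSpace ℝ (Fin 3)))) (Iio (0 : ℝ) ×ˢ (univ : Set (EuclideanSpace ℝ (Fin 3)))) := fun z hz =>
    ⟨show c ^ 2 * z.1 < 0 from mul_neg_of_pos_of_neg (pow_pos hc 2) hz.1, mem_univ _⟩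
  have h := (hV.comp hΦ.continuousOn hmaps).const_smul c
  refine h.congr fun z _ => ?_
  simp only [uncurry, comp_apply, nsRescale, Pi.smul_apply]

/-- the circle point scales: `c • (r cos θ, r sin θ, z) = (cr cos θ, cr sin θ, cz)`. -/
theorem smul_circlePoint (c r θ z : ℝ) :
    c • (WithLp.toLp 2 ![r * Real.cos θ, r * Real.sin θ, z] : (EuclideanSpace ℝ (Fin 3))) =
      (WithLp.toLp 2 ![c * r * Real.cos θ, c * r * Real.sin θ, c * z] : (EuclideanSpace ℝ (Fin 3))) := by
  rw [← WithLp.toLp_smul]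
  congr 1
  funext i
  fin_cases i <;> simp [mul_assoc]

/-- slices of the rescaled profile: `nsRescale c v s = fun y => c • v (c² s) (c • y)`. -/
theorem nsRescale_slice (c : ℝ) (v : ℝ → (EuclideanSpace ℝ (Fin 3)) → (EuclideanSpace ℝ (Fin 3))) (s : ℝ) :
    nsRescale c v s = fun y => c • v (c ^ 2 * s) (c • y) := rfl

/-- vorticity of the rescaled slice: `curl (nsRescale c v s) y = c² • curl (v (c²s)) (c y)`. -/
theorem curl_nsRescale_apply (c : ℝ) (v : ℝ → (EuclideanSpace ℝ (Fin 3)) → (EuclideanSpace ℝ (Fin 3))) (s : ℝ) (y : (EuclideanSpace ℝ (Fin 3))) :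
    curl (nsRescale c v s) y = (c ^ 2) • curl (v (c ^ 2 * s)) (c • y) := by
  rw [nsRescale_slice, curl_smul_comp_smul, ← pow_two]

/-! ## §2 The theorem -/

/-- **Support `ScalingToUnit` (item 26992).** -/
theorem scalingToUnit_proof : Summit.NavierStokesRegularity.NavierStokesRegularity.Theses.AxisTwistDoor.ScalingToUnit := by
  intro hACL C v π H hC hcont hmild hdiv hsw hH hI hsign hcone hsing
  obtain ⟨δ, K, M, hδ, hK, hM, hloc⟩ := hcone
  -- the rescaled profile and its class
  set w : ℝ → (EuclideanSpace ℝ (Fin 3)) → (EuclideanSpace ℝ (Fin 3)) := nsRescale δ v with hw_def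
  set ϖ : ℝ → (EuclideanSpace ℝ (Fin 3)) → ℝ := δ ^ 2 • stPull (δ ^ 2) δ 0 0 π with hϖ_def
  set G : ℝ → (EuclideanSpace ℝ (Fin 3)) → (EuclideanSpace ℝ (Fin 3)) →L[ℝ] (EuclideanSpace ℝ (Fin 3)) := δ ^ 2 • stPull (δ ^ 2) δ 0 0 H with hG_def
  have hC' : HasTypeITimeDecay C w := hC.nsRescale hδ
  have hcont' : ContinuousOn (uncurry w) (Iio (0 : ℝ) ×ˢ univ) := continuousOn_uncurry_nsRescale_slab hcont hδ
  have hmild' : ∀ s t : ℝ, s < t → t < 0 → ∀ x, w t x =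
      UnboundedOperators.heatExtension (w s) (t - s) x - oseenDuhamel 1 s w w t x := by
    intro s t hst ht x
    have hδ2 : 0 < δ ^ 2 := by positivity
    have hst' : δ ^ 2 * s < δ ^ 2 * t := mul_lt_mul_of_pos_left hst hδ2
    have ht' : δ ^ 2 * t < 0 := mul_neg_of_pos_of_neg hδ2 ht
    have key := hmild (δ ^ 2 * s) (δ ^ 2 * t) hst' ht' (δ • x)
    rw [hw_def, RellichScarSimilarityCovariance.nsRescale_eq_smul_stPull]
      -- (buildfix 2026-08-28) qualified: the route file now also brings FluidPDE.nsRescale_eq_smul_stPull into scope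
    rw [heatExtension_smul_stPull hδ 0 (0 : (EuclideanSpace ℝ (Fin 3))) v s (by linarith : 0 < t - s) x,
      oseenDuhamel_smul_stPull hδ 0 (0 : (EuclideanSpace ℝ (Fin 3))) v hst.le x, smul_stPull_apply, zero_add, zero_add, zero_add, key,
      smul_sub, mul_sub]
  have hdiv' : ∀ t < 0, VectorCalculus.IsDivFree (w t) := by
    intro t ht y
    rw [hw_def, nsRescale_slice, divergence_smul_comp_smul,
      hdiv (δ ^ 2 * t) (mul_neg_of_pos_of_neg (by positivity) ht) (δ • y), mul_zero]
  have hsw' : IsSuitableWeakSolutionOn (slab (EuclideanSpace ℝ (Fin 3)) (Iio (0 : ℝ)) isOpen_Iio) 1 0 w ϖ :=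
    isSuitableWeakSolutionOn_nsRescale hsw hδ
  have hH' : HasWeakSpatialGradientOn (slab (EuclideanSpace ℝ (Fin 3)) (Iio (0 : ℝ)) isOpen_Iio) w G :=
    hasWeakSpatialGradientOn_nsRescale hH hδ
  have hI' : typeIBound (Iio (0 : ℝ) ×ˢ univ) w ϖ G < ⊤ := by
    rw [hw_def, hϖ_def, hG_def, typeIBound_nsRescale v π H hδ]; exact hI
  have hsign' : ∀ s < 0, ∀ y, 0 ≤ ⟪curl (w s) y, EuclideanSpace.single (2 : Fin 3) (1 : ℝ)⟫ := by
    intro s hs y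
    rw [hw_def, curl_nsRescale_apply, real_inner_smul_left]
    exact mul_nonneg (by positivity) (hsign (δ ^ 2 * s) (mul_neg_of_pos_of_neg (by positivity) hs) (δ • y))
  -- the unit-cylinder cone for `w` with `(K, M δ²)`
  have hcone' : ∃ K' M' : ℝ, 0 ≤ K' ∧ 0 ≤ M' ∧ ∀ s : ℝ, -1 < s → s < 0 → ∀ r : ℝ, 0 < r → r < 1 → ∀ z : ℝ, |z| < 1 →
      ∫ θ in (0 : ℝ)..(2 * Real.pi), ‖curl (w s) (WithLp.toLp 2 ![r * Real.cos θ, r * Real.sin θ, z] : (EuclideanSpace ℝ (Fin 3))) -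
        ⟪curl (w s) (WithLp.toLp 2 ![r * Real.cos θ, r * Real.sin θ, z] : (EuclideanSpace ℝ (Fin 3))), EuclideanSpace.single (2 : Fin 3) (1 : ℝ)⟫ •
          EuclideanSpace.single (2 : Fin 3) (1 : ℝ)‖ * r ≤
      K' * (∫ θ in (0 : ℝ)..(2 * Real.pi), ⟪curl (w s) (WithLp.toLp 2 ![r * Real.cos θ, r * Real.sin θ, z] : (EuclideanSpace ℝ (Fin 3))),
        EuclideanSpace.single (2 : Fin 3) (1 : ℝ)⟫ * r) + M' * r := by
    refine ⟨K, M * δ ^ 2, hK, by positivity, fun s hs1 hs0 r hr0 hr1 z hz => ?_⟩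
    -- the corresponding local data of `v`
    have hδ2 : 0 < δ ^ 2 := by positivity
    have hs' : -δ ^ 2 < δ ^ 2 * s := by nlinarith
    have hs0' : δ ^ 2 * s < 0 := mul_neg_of_pos_of_neg hδ2 hs0
    have hr' : 0 < δ * r := mul_pos hδ hr0
    have hr1' : δ * r < δ := by nlinarith
    have hz' : |δ * z| < δ := by
      rw [abs_mul, abs_of_pos hδ]; nlinarith [abs_nonneg z]
    have key := hloc (δ ^ 2 * s) hs' hs0' (δ * r) hr' hr1' (δ * z) hz'
    -- rewrite the integrands of `w` through those of `v`
    set e : (EuclideanSpace ℝ (Fin 3)) := EuclideanSpace.single (2 : Fin 3) (1 : ℝ) with he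
    set P : ℝ → (EuclideanSpace ℝ (Fin 3)) := fun θ => (WithLp.toLp 2 ![δ * r * Real.cos θ, δ * r * Real.sin θ, δ * z] : (EuclideanSpace ℝ (Fin 3))) with hP
    have hpt : ∀ θ : ℝ, curl (w s) (WithLp.toLp 2 ![r * Real.cos θ, r * Real.sin θ, z] : (EuclideanSpace ℝ (Fin 3))) =
        (δ ^ 2) • curl (v (δ ^ 2 * s)) (P θ) := by
      intro θ
      rw [hw_def, curl_nsRescale_apply, smul_circlePoint]
    have hL : (fun θ => ‖curl (w s) (WithLp.toLp 2 ![r * Real.cos θ, r * Real.sin θ, z] : (EuclideanSpace ℝ (Fin 3))) -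
          ⟪curl (w s) (WithLp.toLp 2 ![r * Real.cos θ, r * Real.sin θ, z] : (EuclideanSpace ℝ (Fin 3))), e⟫ • e‖ * r) =
        fun θ => δ * (‖curl (v (δ ^ 2 * s)) (P θ) - ⟪curl (v (δ ^ 2 * s)) (P θ), e⟫ • e‖ * (δ * r)) := by
      funext θ
      rw [hpt θ, real_inner_smul_left, ← smul_smul, ← smul_sub, norm_smul, Real.norm_of_nonneg hδ2.le]
      ring
    have hR : (fun θ => ⟪curl (w s) (WithLp.toLp 2 ![r * Real.cos θ, r * Real.sin θ, z] : (EuclideanSpace ℝ (Fin 3))), e⟫ * r) =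
        fun θ => δ * (⟪curl (v (δ ^ 2 * s)) (P θ), e⟫ * (δ * r)) := by
      funext θ
      rw [hpt θ, real_inner_smul_left]
      ring
    rw [hL, hR, intervalIntegral.integral_const_mul, intervalIntegral.integral_const_mul]
    have key' := mul_le_mul_of_nonneg_left key hδ.le
    calc δ * ∫ θ in (0 : ℝ)..(2 * Real.pi), ‖curl (v (δ ^ 2 * s)) (P θ) - ⟪curl (v (δ ^ 2 * s)) (P θ), e⟫ • e‖ * (δ * r)
        ≤ δ * (K * (∫ θ in (0 : ℝ)..(2 * Real.pi), ⟪curl (v (δ ^ 2 * s)) (P θ), e⟫ * (δ * r)) + M * (δ * r)) := key'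
      _ = K * (δ * ∫ θ in (0 : ℝ)..(2 * Real.pi), ⟪curl (v (δ ^ 2 * s)) (P θ), e⟫ * (δ * r)) + M * δ ^ 2 * r := by
          ring
  -- the averaged-cone Liouville theorem for `w`, transported back
  have hw : ¬ IsBackwardSingularPoint w 0 := hACL C w ϖ G hC' hcont' hmild' hdiv' hsw' hH' hI' hsign' hcone'
  exact hw (isBackwardSingularPoint_nsRescale hsing hδ)

end Summit.NavierStokesRegularity.NavierStokesRegularity.Theorems.AxisTwistDoorScalingToUnit

end
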